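import Summits.QuantumFields.YangMills.Theorems.FluctuationComparisonRegPrIntLOrganTangentMarginalHClauseLetters
import HarnessLib

/-!
# Crux `FluctuationComparisonRegPrIntL` (stmt-QuantumFields-20520, rung R3), PATH-B organ, v18 (H-currency): tool brick (MH), PART 2 —
# «THE MARGINAL IS H-PRESENTABLE»: `U ↦ β·Σ_p c_p·(1 − Re tr U(∂p))` satisfies the one-bond-pair clause `HClauseSq θ r k_W` with EXPLICIT letters
# `k_W b b′ = 3·β·θ²·Σ_p |c_p|·𝟙[b, b′ ∈ ∂p]`, whose row-mass is `≤ 3·β·θ²·(sup|c|)·16·e^{2κ}` in `d = 3`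

Cell `ym3-torus` (YM ladder rung R3 = continuum `SU(2)` Yang–Mills on the three-torus — a RUNG: NOT d = 4, NOT infinite volume, NOT a mass gap,
NOT Clay).  Width seat `ym3-torus-px8` (gen 20), LEAD `ym-ust-20520-w3` g25 WORD №3 tool brick **(MH)** (one of three v18-text-independent H-currency
tool bricks, with (T2) px20 g17 and (KIT) ym-line-cst-p1 g41; named seat px13 g21 took its own S2β pen, fallback w5 g22 handed the pen on with the plan
`MH-PLAN-w5g22.md`, which this file executes); `--kind proof --supports stmt-QuantumFields-20520 --as helper`, count-neutral, DEFINITION-FREE (the crux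
file's `HClauseSq` text — `Cruxes/FluctuationComparisonRegPrIntL/V18DraftTexts.lean` v0.3 :50, = ✓p797413 brick T's hypothesis `h` — is INLINED, as in
✓p804070 BRICK 1 `…OrganTangentTaylorCutH` and ✓p802938 `…OrganTangentJunctionDirectTransportCore`), default heartbeats, `autoImplicit false`;
registry `Lines/semiclassical_s2beta.lean` and `Lines/runpair_organ.lean` untouched.  PART 1 = `…OrganTangentMarginalHClauseLetters` (the per-plaquette
bilinear bound ★★`abs_secondDiff_reTr_plaqHol_le`).

WHAT THIS IS.  In every H-presentation `(c′, a′, w′, k′)` of the organ-tangent lane (LINᵘ-H ∕ JENᵘ-H ∕ O1ᵘ-H v2, BRICK 1) a function `f` on the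
`θ`-window is presented as «MARGINAL + H-CLAUSE»: `f − β_j·Σ_p c′_p·(1 − reTr U(∂p))` satisfies the scaled one-bond-pair clause `HClauseSq θ r k′`
(for one-bond moves `U → V` at `b` by `e^{v}`, `U → W`, `V → Z` at `b′` by `e^{v′}`, all four corners `θ`-small, caps `‖v‖, ‖v′‖ ≤ r·θ`:
`|f Z − f V − f W + f U| ≤ k′ b b′·(‖v‖∕θ)·(‖v′‖∕θ)`).  This file shows that THE MARGINAL ITSELF IS H-PRESENTABLE with explicit, field-uniform
letters — so marginal-slot and marginal-free editions of any H-presentation differ by a bookkeeping step only (ideator g27 №10 (2)(ii); LEAD №3: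
«`θ·x′ ≤ 48·e^{2κ}·θ·a`, no re-type ever needed»; the clause algebra (K1)–(K6) that combines presentations is the (KIT) brick, not restated here):
* `kW_nonneg` — the letters are `≥ 0` (the clause package's first conjunct);
* ★★ `hClauseSq_marginal` — for `c : Plaq → ℝ`, `0 ≤ β`, `0 < θ`, ANY cap `r`: the `HClauseSq θ r k_W R` TEXT for
  `R U := β·Σ_p c_p·(1 − reTr U(∂p))` with `k_W b b′ := 3·β·θ²·Σ_p |c_p|·(if IsLetter b p ∧ IsLetter b′ p then 1 else 0)`
  (the `PlaqSmall` corner hypotheses and the caps are NOT used: the bound is global; `dist1(e^{v}) ≤ √3‖v‖`, ✓px19 Core `dist1_expPt_le_sqrt3_mul_norm`);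
* ★ `rowMass_marginal_le` ∕ ★ `rowMass_marginal_le_of_d_eq_three` — `Σ_{b′} k_W b b′·e^{κ·|b₋ − b′₋|₁} ≤ 3·β·θ²·a·(8(d−1))·e^{2κ}`
  (`= 3·β·θ²·a·16·e^{2κ}` for `d = 3`) whenever `|c_p| ≤ a` and `0 ≤ κ`: a bond is a letter of `2(d−1)` plaquettes (lit ✓`T4WilsonLinkAffine.letterCount_eq`),
  a plaquette has four letters (`sum_letters_exp_le`), and two letters of one plaquette have sources at `ℓ¹`-distance `≤ 2` (`tdist_src_le_two_of_isLetter`,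
  over lit ✓`B3Taylor310LocalRemainder.tdist_triangle∕tdist_comm∕tdist_self`).
USAGE (consumer side, e.g. under BRICK 1's binders with `β := L^j∕γ`, `θ := θBal_j∕4`): `hClauseSq_marginal c hβ hθ r` IS the clause
`HClauseSq θ r k_W (fun U => β * ∑ p, c p * (1 - reTr (GaugeField.plaqHol U p)))` after `unfold HClauseSq` (β-reduction only).

HONEST FRAMING: lattice ∕ `2 × 2`-matrix bookkeeping [folklore]; nothing of Bałaban's analysis is asserted or proved; LINᵘ-H ∕ JENᵘ-H ∕ O1ᵘ-H v2
(XL, the crux of the crux), S1aᴴ, S2α′, S2β, the five registered ∘-stubs OPEN; crux 20520 `FluctuationComparisonRegPrIntL` ∕ `YM3TorusSU2` NOT proved;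
no summit ∕ sub-problem statement is proved by a helper; rung R3 = SU(2) YM₃ on T³ at fixed lattice data — NOT d = 4, NOT infinite volume, NOT a mass gap,
NOT Clay; the Yang–Mills mass gap is NOT proved.  LOCATE: the Wilson action's link structure = T. Bałaban, CMP **102** (1985) 277–309
[Balaban1985Variational] (30)–(33) pp.282–283 (the second-order expansion of the plaquette action with quartic remainder; shape only, nothing cited as a fact — lit g31 PENS NOTE 03:23:48Z page check); the one-bond-pair clause is the organ's own currency (ideator g26
`CURRENCY-MEMO-g26.md` §8), not a printed object.
-/

set_option autoImplicit false

noncomputable section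

open scoped BigOperators
open Literature.MathematicalPhysics.QuantumFieldTheory.Balaban1983to89
open T4CubeChartGnomonic (SU2)
open T4CubeChartExp (expPt)
open T4WilsonLinkAffine (bond₁ bond₂ bond₃ bond₄ IsLetter letterCount letterCount_eq)
open B3Taylor310LocalRemainder (tdist_comm tdist_self tdist_triangle)
open Summit.QuantumFields.YangMills.Theorems.OrganTangentJunctionDirectTransportCore (dist1_expPt_le_sqrt3_mul_norm)
open Summit.QuantumFields.YangMills.Theorems.OrganTangentMarginalHClauseLetters (abs_secondDiff_reTr_plaqHol_le)

namespace Summit.QuantumFields.YangMills.Theorems.OrganTangentMarginalHClause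

/-! ## §4  ★★ (MH): the marginal satisfies the clause `HClauseSq θ r k_W` -/

section Marginal

variable {P : Params} {j : ℕ} [DecidableEq (PBond P j)]

/-- The marginal's letters are nonnegative (first conjunct of every H-presentation). [folklore] -/
theorem kW_nonneg (c : Plaq P j → ℝ) {β : ℝ} (hβ : 0 ≤ β) (θ : ℝ) (b b' : PBond P j) :
    0 ≤ 3 * β * θ ^ 2 * ∑ p, |c p| * (if IsLetter b p ∧ IsLetter b' p then (1:ℝ) else 0) :=
  mul_nonneg (mul_nonneg (mul_nonneg (by norm_num) hβ) (sq_nonneg θ))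
    (Finset.sum_nonneg fun p _ => mul_nonneg (abs_nonneg _) (by split_ifs <;> norm_num))

/-- ★★ **(MH) THE MARGINAL IS H-PRESENTABLE.**  For `c : Plaq → ℝ`, `0 ≤ β`, `0 < θ` and ANY cap `r`, the crux file's clause text
`HClauseSq θ r k_W R` (✓p797413 brick T's hypothesis, INLINED) holds for `R U := β·Σ_p c_p·(1 − reTr U(∂p))` with the explicit letters
`k_W b b′ := 3·β·θ²·Σ_p |c_p|·(if IsLetter b p ∧ IsLetter b′ p then 1 else 0)`.  The window and cap hypotheses are not used. [folklore] -/
theorem hClauseSq_marginal (c : Plaq P j → ℝ) {β θ : ℝ} (hβ : 0 ≤ β) (hθ : 0 < θ) (r : ℝ) :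
    ∀ (b b' : PBond P j) (v v' : Fin 3 → ℝ) (U V W Z : GaugeField P j SU2),
      ‖v‖ ≤ r * θ → ‖v'‖ ≤ r * θ → PlaqSmall θ U → PlaqSmall θ V → PlaqSmall θ W → PlaqSmall θ Z →
      (∀ e, e ≠ b → V e = U e) → V b = U b * expPt v → (∀ e, e ≠ b' → W e = U e) → W b' = U b' * expPt v' →
      (∀ e, e ≠ b' → Z e = V e) → Z b' = V b' * expPt v' →
      |(β * ∑ p, c p * (1 - reTr (GaugeField.plaqHol Z p))) - (β * ∑ p, c p * (1 - reTr (GaugeField.plaqHol V p))) -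
          (β * ∑ p, c p * (1 - reTr (GaugeField.plaqHol W p))) + (β * ∑ p, c p * (1 - reTr (GaugeField.plaqHol U p)))| ≤
        (3 * β * θ ^ 2 * ∑ p, |c p| * (if IsLetter b p ∧ IsLetter b' p then (1:ℝ) else 0)) * (‖v‖ / θ) * (‖v'‖ / θ) := by
  intro b b' v v' U V W Z _ _ _ _ _ _ hV hVb hW hWb hZ hZb
  have hθ0 : θ ≠ 0 := hθ.ne'
  -- the distance product of the two moves
  have hd : 0 ≤ dist1 (expPt v) := GaugeGroup.dist1_nonneg _
  have hd' : 0 ≤ dist1 (expPt v') := GaugeGroup.dist1_nonneg _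
  have hdd : dist1 (expPt v) * dist1 (expPt v') ≤ 3 * ‖v‖ * ‖v'‖ := by
    have h3 : Real.sqrt 3 * Real.sqrt 3 = 3 := Real.mul_self_sqrt (by norm_num)
    calc dist1 (expPt v) * dist1 (expPt v') ≤ (Real.sqrt 3 * ‖v‖) * (Real.sqrt 3 * ‖v'‖) :=
          mul_le_mul (dist1_expPt_le_sqrt3_mul_norm v) (dist1_expPt_le_sqrt3_mul_norm v') hd'
            (mul_nonneg (Real.sqrt_nonneg _) (norm_nonneg _))
      _ = (Real.sqrt 3 * Real.sqrt 3) * ‖v‖ * ‖v'‖ := by ring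
      _ = 3 * ‖v‖ * ‖v'‖ := by rw [h3]
  -- one sum
  rw [Finset.mul_sum, Finset.mul_sum, Finset.mul_sum, Finset.mul_sum, ← Finset.sum_sub_distrib, ← Finset.sum_sub_distrib,
    ← Finset.sum_add_distrib]
  -- the right-hand side as a sum
  have hR : (3 * β * θ ^ 2 * ∑ p, |c p| * (if IsLetter b p ∧ IsLetter b' p then (1:ℝ) else 0)) * (‖v‖ / θ) * (‖v'‖ / θ) =
      ∑ p, β * |c p| * ((if IsLetter b p ∧ IsLetter b' p then (1:ℝ) else 0) * (3 * ‖v‖ * ‖v'‖)) := by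
    rw [Finset.mul_sum, Finset.sum_mul, Finset.sum_mul]
    refine Finset.sum_congr rfl fun p _ => ?_
    field_simp
  rw [hR]
  refine (Finset.abs_sum_le_sum_abs _ _).trans (Finset.sum_le_sum fun p _ => ?_)
  have e : β * (c p * (1 - reTr (GaugeField.plaqHol Z p))) - β * (c p * (1 - reTr (GaugeField.plaqHol V p))) -
        β * (c p * (1 - reTr (GaugeField.plaqHol W p))) + β * (c p * (1 - reTr (GaugeField.plaqHol U p))) =
      -(β * (c p * (reTr (GaugeField.plaqHol Z p) - reTr (GaugeField.plaqHol V p) - reTr (GaugeField.plaqHol W p) +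
        reTr (GaugeField.plaqHol U p)))) := by ring
  rw [e, abs_neg, abs_mul, abs_mul, abs_of_nonneg hβ]
  have hp := abs_secondDiff_reTr_plaqHol_le p hV hVb hW hWb hZ hZb
  have hι : 0 ≤ (if IsLetter b p ∧ IsLetter b' p then (1:ℝ) else 0) := by split_ifs <;> norm_num
  calc β * (|c p| * |reTr (GaugeField.plaqHol Z p) - reTr (GaugeField.plaqHol V p) - reTr (GaugeField.plaqHol W p) +
          reTr (GaugeField.plaqHol U p)|)
      ≤ β * (|c p| * ((if IsLetter b p ∧ IsLetter b' p then (1:ℝ) else 0) * (dist1 (expPt v) * dist1 (expPt v')))) :=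
        mul_le_mul_of_nonneg_left (mul_le_mul_of_nonneg_left hp (abs_nonneg _)) hβ
    _ ≤ β * (|c p| * ((if IsLetter b p ∧ IsLetter b' p then (1:ℝ) else 0) * (3 * ‖v‖ * ‖v'‖))) := by
        gcongr
    _ = β * |c p| * ((if IsLetter b p ∧ IsLetter b' p then (1:ℝ) else 0) * (3 * ‖v‖ * ‖v'‖)) := by ring

end Marginal

/-! ## §5  ★ The row-mass of the marginal's letters -/

section RowMass

variable {P : Params} {j : ℕ} [DecidableEq (PBond P j)]

omit [DecidableEq (PBond P j)] in
/-- Two letters of one plaquette have sources at `ℓ¹`-distance `≤ 2` (one lattice step has length `≤ 1` — cf. the tree's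
`Balaban3D.Proofs.Run3Collar.tdist_shift_le`, re-derived inline to keep the import closure light — and the triangle inequality
lit ✓`B3Taylor310LocalRemainder.tdist_triangle`). [folklore] -/
theorem tdist_src_le_two_of_isLetter {p : Plaq P j} {b b' : PBond P j} (hb : IsLetter b p) (hb' : IsLetter b' p) :
    Site.tdist b.src b'.src ≤ 2 := by
  classical
  -- one lattice step: `|y − (y + e_κ)|₁ ≤ 1` (adapted from `Summits/QuantumFields/Balaban3D/Proofs/Run3Collar.lean`)
  have hstep : ∀ (y : Site P j) (κ : Fin P.d), Site.tdist y (y.shift κ) ≤ 1 := by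
    intro y κ
    unfold Site.tdist
    have hone : (1 : ZMod (P.sitesPerDir j)).val ≤ 1 := by
      rw [ZMod.val_one_eq_one_mod]; exact Nat.mod_le 1 _
    have hterm : ∀ ι, min (y ι - y.shift κ ι).val (y.shift κ ι - y ι).val ≤ if ι = κ then 1 else 0 := by
      intro ι
      by_cases hι : ι = κ
      · subst hι
        simp only [Site.shift, Function.update_self, if_true]
        refine (min_le_right _ _).trans ?_
        rw [add_sub_cancel_left]
        exact hone
      · simp [Site.shift, hι]
    calc ∑ ι, min (y ι - y.shift κ ι).val (y.shift κ ι - y ι).val ≤ ∑ ι : Fin P.d, (if ι = κ then 1 else 0) :=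
          Finset.sum_le_sum fun ι _ => hterm ι
      _ = 1 := by simp
  have h0 : ∀ y : Site P j, Site.tdist y y ≤ 2 := fun y => (tdist_self y).le.trans (by norm_num)
  have h1 : ∀ (y : Site P j) (κ : Fin P.d), Site.tdist y (y.shift κ) ≤ 2 := fun y κ => (hstep y κ).trans (by norm_num)
  have h1' : ∀ (y : Site P j) (κ : Fin P.d), Site.tdist (y.shift κ) y ≤ 2 :=
    fun y κ => ((tdist_comm _ _).trans_le (hstep y κ)).trans (by norm_num)
  have h2 : ∀ (y : Site P j) (μ ν : Fin P.d), Site.tdist (y.shift μ) (y.shift ν) ≤ 2 := fun y μ ν =>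
    calc Site.tdist (y.shift μ) (y.shift ν) ≤ Site.tdist (y.shift μ) y + Site.tdist y (y.shift ν) := tdist_triangle _ _ _
      _ ≤ 1 + 1 := Nat.add_le_add ((tdist_comm _ _).trans_le (hstep y μ)) (hstep y ν)
  rcases hb with rfl | rfl | rfl | rfl <;> rcases hb' with rfl | rfl | rfl | rfl
  exacts [h0 p.src, h1 p.src p.μ, h1 p.src p.ν, h0 p.src,
    h1' p.src p.μ, h0 _, h2 p.src p.μ p.ν, h1' p.src p.μ,
    h1' p.src p.ν, h2 p.src p.ν p.μ, h0 _, h1' p.src p.ν,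
    h0 p.src, h1 p.src p.μ, h1 p.src p.ν, h0 p.src]

/-- The inner sum: for a letter `b` of `p`, `Σ_{b′} 𝟙[b, b′ ∈ ∂p]·e^{κ|b₋ − b′₋|} ≤ 4·e^{2κ}` (`κ ≥ 0`); `0` if `b ∉ ∂p`. [folklore] -/
theorem sum_letters_exp_le (p : Plaq P j) (b : PBond P j) {κ : ℝ} (hκ : 0 ≤ κ) :
    ∑ b' : PBond P j, (if IsLetter b p ∧ IsLetter b' p then (1:ℝ) else 0) * Real.exp (κ * (b.src.tdist b'.src : ℝ)) ≤
      (if IsLetter b p then (1:ℝ) else 0) * (4 * Real.exp (2 * κ)) := by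
  by_cases hb : IsLetter b p
  · rw [if_pos hb, one_mul]
    -- each term is `≤ e^{2κ}` on the letters of `p` and `0` elsewhere
    have hle : ∀ b' : PBond P j, (if IsLetter b p ∧ IsLetter b' p then (1:ℝ) else 0) * Real.exp (κ * (b.src.tdist b'.src : ℝ)) ≤
        (if b' ∈ ({bond₁ p, bond₂ p, bond₃ p, bond₄ p} : Finset (PBond P j)) then (1:ℝ) else 0) * Real.exp (2 * κ) := by
      intro b'
      by_cases hb' : IsLetter b' p
      · have hmem : b' ∈ ({bond₁ p, bond₂ p, bond₃ p, bond₄ p} : Finset (PBond P j)) := by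
          rcases hb' with h | h | h | h <;> simp [h]
        rw [if_pos ⟨hb, hb'⟩, if_pos hmem, one_mul, one_mul]
        exact Real.exp_le_exp.2 (by
          have := tdist_src_le_two_of_isLetter hb hb'
          calc κ * (b.src.tdist b'.src : ℝ) ≤ κ * 2 := mul_le_mul_of_nonneg_left (by exact_mod_cast this) hκ
            _ = 2 * κ := by ring)
      · rw [if_neg (fun h => hb' h.2), zero_mul]
        exact mul_nonneg (by split_ifs <;> norm_num) (Real.exp_nonneg _)
    refine (Finset.sum_le_sum fun b' _ => hle b').trans ?_
    rw [← Finset.sum_mul, Finset.sum_ite_mem, Finset.univ_inter, Finset.sum_const, nsmul_eq_mul, mul_one]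
    refine mul_le_mul_of_nonneg_right ?_ (Real.exp_nonneg _)
    have hcard : (({bond₁ p, bond₂ p, bond₃ p, bond₄ p} : Finset (PBond P j)).card : ℝ) ≤ 4 := by
      exact_mod_cast (Finset.card_insert_le _ _).trans (Nat.succ_le_succ ((Finset.card_insert_le _ _).trans
        (Nat.succ_le_succ ((Finset.card_insert_le _ _).trans (Nat.succ_le_succ (Finset.card_singleton _).le)))))
    exact hcard
  · rw [if_neg hb, zero_mul]
    refine (Finset.sum_nonpos fun b' _ => ?_)
    rw [if_neg (fun h => hb h.1), zero_mul]

/-- ★ **ROW-MASS OF THE MARGINAL'S LETTERS** (general dimension): if `|c_p| ≤ a` for all `p`, `0 ≤ β` and `0 ≤ κ`, then for every bond `b`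
`Σ_{b′} k_W b b′·e^{κ·|b₋ − b′₋|₁} ≤ 3·β·θ²·a·(8(d − 1))·e^{2κ}` (`2(d−1)` plaquettes through `b`, lit ✓`letterCount_eq`; four letters each;
letter sources at distance `≤ 2`). [folklore] -/
theorem rowMass_marginal_le (c : Plaq P j → ℝ) {a β κ : ℝ} (θ : ℝ) (ha : ∀ p, |c p| ≤ a) (hβ : 0 ≤ β) (hκ : 0 ≤ κ) (b : PBond P j) :
    ∑ b' : PBond P j, (3 * β * θ ^ 2 * ∑ p, |c p| * (if IsLetter b p ∧ IsLetter b' p then (1:ℝ) else 0)) *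
        Real.exp (κ * (b.src.tdist b'.src : ℝ)) ≤
      3 * β * θ ^ 2 * a * (8 * (P.d - 1 : ℕ)) * Real.exp (2 * κ) := by
  have hC : 0 ≤ 3 * β * θ ^ 2 := mul_nonneg (mul_nonneg (by norm_num) hβ) (sq_nonneg θ)
  -- swap the sums
  have e1 : ∑ b' : PBond P j, (3 * β * θ ^ 2 * ∑ p, |c p| * (if IsLetter b p ∧ IsLetter b' p then (1:ℝ) else 0)) *
        Real.exp (κ * (b.src.tdist b'.src : ℝ)) =
      3 * β * θ ^ 2 * ∑ p, |c p| * ∑ b' : PBond P j, (if IsLetter b p ∧ IsLetter b' p then (1:ℝ) else 0) *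
        Real.exp (κ * (b.src.tdist b'.src : ℝ)) := by
    simp only [Finset.mul_sum, Finset.sum_mul]
    rw [Finset.sum_comm]
    refine Finset.sum_congr rfl fun p _ => Finset.sum_congr rfl fun b' _ => by ring
  rw [e1]
  -- bound the inner sums
  have e2 : ∑ p, |c p| * ∑ b' : PBond P j, (if IsLetter b p ∧ IsLetter b' p then (1:ℝ) else 0) * Real.exp (κ * (b.src.tdist b'.src : ℝ)) ≤
      ∑ p, a * ((if IsLetter b p then (1:ℝ) else 0) * (4 * Real.exp (2 * κ))) :=
    Finset.sum_le_sum fun p _ => mul_le_mul (ha p) (sum_letters_exp_le p b hκ)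
      (Finset.sum_nonneg fun b' _ => mul_nonneg (by split_ifs <;> norm_num) (Real.exp_nonneg _)) ((abs_nonneg _).trans (ha p))
  refine (mul_le_mul_of_nonneg_left e2 hC).trans (le_of_eq ?_)
  -- count the plaquettes through `b`
  have e3 : ∑ p : Plaq P j, (if IsLetter b p then (1:ℝ) else 0) = (letterCount b : ℝ) := by
    rw [letterCount, Finset.sum_boole]
  rw [← Finset.mul_sum, ← Finset.sum_mul, e3, letterCount_eq]
  push_cast
  ring

/-- ★ **ROW-MASS OF THE MARGINAL'S LETTERS, `d = 3`** (the cell's tori): `Σ_{b′} k_W b b′·e^{κ·|b₋ − b′₋|₁} ≤ 3·β·θ²·a·16·e^{2κ}`. [folklore] -/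
theorem rowMass_marginal_le_of_d_eq_three (hd : P.d = 3) (c : Plaq P j → ℝ) {a β κ : ℝ} (θ : ℝ) (ha : ∀ p, |c p| ≤ a)
    (hβ : 0 ≤ β) (hκ : 0 ≤ κ) (b : PBond P j) :
    ∑ b' : PBond P j, (3 * β * θ ^ 2 * ∑ p, |c p| * (if IsLetter b p ∧ IsLetter b' p then (1:ℝ) else 0)) *
        Real.exp (κ * (b.src.tdist b'.src : ℝ)) ≤
      3 * β * θ ^ 2 * a * 16 * Real.exp (2 * κ) := by
  have h := rowMass_marginal_le c θ ha hβ hκ b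
  have h2 : ((P.d - 1 : ℕ) : ℝ) = 2 := by rw [hd]; norm_num
  rw [h2] at h
  linarith

end RowMass

end Summit.QuantumFields.YangMills.Theorems.OrganTangentMarginalHClause

end
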